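/-
Copyright (c) 2026 the pub-hodgecm-mathlib formalisation cell (harness21).  Prover seat hodgecm-mathlib-LH4-p07 (g7), Track A «(D-RAM) FOUR-FRAME», unit U2H, the census leaf
(ρ2b′-X) `stub_U2H_fixedPointCensus_typeTwo_unit0` — the typed bottom sockets (A)∕(B)∕(C) of the order-count census (payer LH4-p14 (g4) MAP v3): the closing ARITHMETIC, shared by
all three descent types.  2026-09-04.
-/
import Mathlib.Algebra.Ring.GeomSum
import Mathlib.Tactic.LinearCombination
import Mathlib.Tactic.Ring
import Mathlib.Tactic.Push
import Mathlib.Tactic.NormNum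
import HarnessLib

/-!
# The closing arithmetic of the order-count census bottoms

Each typed bottom socket of the (ρ2b′-X) census (texts `SOCKET-hOCA∕B∕C.v1`, payer LH4-p14 (g4)) concludes an identity of the shape
`(q − 1)·(A − A′) = ε · q^m · ((q − 1)·(F + d%2) − 2·(q^S − 1))` in `ℤ` (`A`, `A′` the two ℕ order counts, `F = #Fix`, `ε = (β,θ)_v = ±1`), and is assembled from
three organs: the T5s WELD `ε·(A − A′) = q^m·(2·Σ_{i<n+1} q^i − 2·Σ_{i<S} q^i)` (in `ℚ`), the H-SIDE closed form `(q − 1)·(F + d%2) + 2 = c·q^(n+1)` (in `ℕ`; `c = 2` at an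
Eisenstein descent, `c = q + 1` at an inert one — then the weld's leading sum reads `1 + (q+1)·Σ_{i<n} q^i`), and the SIGN `ε = ±1`.  THIS FILE is that last step, once, type-free:
`(q − 1)·Σ_{i<k} q^i = q^k − 1` and two `linear_combination`s.
* `geom_sum_pred_mul` — `((q:ℤ) − 1)·Σ_{i<k} q^i = q^k − 1`.
* `census_bottom_arith_eisenstein` — the Eisenstein shape (types U-RamK (B) and RM (C)).
* `census_bottom_arith_inert` — the inert shape (type U-Unr (A)).
HONEST LABEL: HC_CM is proved only modulo the 7 printed citations (2 remaining named inputs: hLiu418 = stmt-HodgeConjecture-24832,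
h413 = stmt-HodgeConjecture-24833) until rung 0 closes; (ρ2b′-X) :418 is an OPEN prover target — this file is a helper (`--supports`), proofs only, closes no socket.
-/

set_option autoImplicit false

open Finset

namespace Summit.HodgeConjecture.HodgeConjecture.Cruxes.H413.F0P3cDyRamCensusBottomArith

/-- `(q − 1)·Σ_{i<k} qⁱ = qᵏ − 1` in `ℤ`. [cite: Serre1979, Ch. V §3] -/
theorem geom_sum_pred_mul (q k : ℕ) : ((q : ℤ) - 1) * ∑ i ∈ range k, (q : ℤ) ^ i = (q : ℤ) ^ k - 1 := by
  rw [mul_comm]; exact geom_sum_mul (q : ℤ) k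

/-- `(q − 1)·Σ_{i<k} qⁱ = qᵏ − 1` in `ℚ`. [cite: Serre1979, Ch. V §3] -/
theorem geom_sum_pred_mul_rat (q k : ℕ) : ((q : ℚ) - 1) * ∑ i ∈ range k, (q : ℚ) ^ i = (q : ℚ) ^ k - 1 := by
  rw [mul_comm]; exact geom_sum_mul (q : ℚ) k

/-- **THE CLOSING ARITHMETIC, EISENSTEIN SHAPE** (bottoms (B) U-RamK and (C) RM).  From the weld `ε·(A − A′) = q^m·(2·Σ_{i<n+1} qⁱ − 2·Σ_{i<S} qⁱ)` (`ℚ`), the H-side law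
`(q − 1)·(F + r) + 2 = 2·q^(n+1)` (`ℕ`) and `ε = ±1`:  `(q − 1)·(A − A′) = ε·q^m·((q − 1)·(F + r) − 2·(q^S − 1))` (`ℤ`).
[cite: Rogawski1990, §4.9 Prop. 4.9.1 (b) p. 55] [cite: Kottwitz1986BaseChangeUnits, §1 pp. 240–241] -/
theorem census_bottom_arith_eisenstein {q m n S F r A A' : ℕ} {ε : ℤ} (hε : ε = 1 ∨ ε = -1)
    (hweld : (ε : ℚ) * (((A : ℕ) : ℚ) - ((A' : ℕ) : ℚ)) =
      (q : ℚ) ^ m * (2 * ∑ i ∈ range (n + 1), (q : ℚ) ^ i - 2 * ∑ i ∈ range S, (q : ℚ) ^ i))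
    (hH : (q - 1) * (F + r) + 2 = 2 * q ^ (n + 1)) (hq : 1 ≤ q) :
    ((q : ℤ) - 1) * ((A : ℤ) - (A' : ℤ)) = ε * (q : ℤ) ^ m * (((q : ℤ) - 1) * ((F + r : ℕ) : ℤ) - 2 * ((q : ℤ) ^ S - 1)) := by
  -- the H-side law in `ℤ`
  have hHZ : ((q : ℤ) - 1) * ((F + r : ℕ) : ℤ) + 2 = 2 * (q : ℤ) ^ (n + 1) := by
    have h := congrArg (fun x : ℕ => (x : ℤ)) hH
    push_cast [Nat.cast_sub hq] at h
    push_cast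
    exact h
  -- the weld in `ℤ`: clear the two geometric sums
  have hε2 : (ε : ℚ) * ε = 1 := by rcases hε with h | h <;> simp [h]
  have hweldZ : ((q : ℤ) - 1) * ((A : ℤ) - (A' : ℤ)) = ε * (q : ℤ) ^ m * (2 * ((q : ℤ) ^ (n + 1) - 1) - 2 * ((q : ℤ) ^ S - 1)) := by
    have h1 := geom_sum_pred_mul_rat q (n + 1)
    have h2 := geom_sum_pred_mul_rat q S
    have key : (((q : ℤ) - 1) * ((A : ℤ) - (A' : ℤ)) : ℚ) = ((ε * (q : ℤ) ^ m * (2 * ((q : ℤ) ^ (n + 1) - 1) - 2 * ((q : ℤ) ^ S - 1)) : ℤ) : ℚ) := by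
      push_cast
      linear_combination (ε * ((q : ℚ) - 1)) * hweld + (2 * ε * (q : ℚ) ^ m) * h1 - (2 * ε * (q : ℚ) ^ m) * h2 -
        (((q : ℚ) - 1) * (((A : ℕ) : ℚ) - ((A' : ℕ) : ℚ))) * hε2
    exact_mod_cast key
  rw [hweldZ]
  linear_combination (-(ε * (q : ℤ) ^ m)) * hHZ

/-- **THE CLOSING ARITHMETIC, INERT SHAPE** (bottom (A) U-Unr).  From the weld `ε·(A − A′) = q^m·((1 + (q+1)·Σ_{i<n} qⁱ) − 2·Σ_{i<S} qⁱ)` (`ℚ`), the H-side law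
`(q − 1)·(F + r) + 2 = (q + 1)·q^n` (`ℕ`) and `ε = ±1`:  `(q − 1)·(A − A′) = ε·q^m·((q − 1)·(F + r) − 2·(q^S − 1))` (`ℤ`).
[cite: Rogawski1990, §4.9 Prop. 4.9.1 (b) p. 55] [cite: Kottwitz1986BaseChangeUnits, §1 pp. 240–241] -/
theorem census_bottom_arith_inert {q m n S F r A A' : ℕ} {ε : ℤ} (hε : ε = 1 ∨ ε = -1)
    (hweld : (ε : ℚ) * (((A : ℕ) : ℚ) - ((A' : ℕ) : ℚ)) =
      (q : ℚ) ^ m * ((1 + ((q : ℚ) + 1) * ∑ i ∈ range n, (q : ℚ) ^ i) - 2 * ∑ i ∈ range S, (q : ℚ) ^ i))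
    (hH : (q - 1) * (F + r) + 2 = (q + 1) * q ^ n) (hq : 1 ≤ q) :
    ((q : ℤ) - 1) * ((A : ℤ) - (A' : ℤ)) = ε * (q : ℤ) ^ m * (((q : ℤ) - 1) * ((F + r : ℕ) : ℤ) - 2 * ((q : ℤ) ^ S - 1)) := by
  have hHZ : ((q : ℤ) - 1) * ((F + r : ℕ) : ℤ) + 2 = ((q : ℤ) + 1) * (q : ℤ) ^ n := by
    have h := congrArg (fun x : ℕ => (x : ℤ)) hH
    push_cast [Nat.cast_sub hq] at h
    push_cast
    exact h
  have hε2 : (ε : ℚ) * ε = 1 := by rcases hε with h | h <;> simp [h]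
  have hweldZ : ((q : ℤ) - 1) * ((A : ℤ) - (A' : ℤ)) =
      ε * (q : ℤ) ^ m * ((((q : ℤ) - 1) + ((q : ℤ) + 1) * ((q : ℤ) ^ n - 1)) - 2 * ((q : ℤ) ^ S - 1)) := by
    have h1 := geom_sum_pred_mul_rat q n
    have h2 := geom_sum_pred_mul_rat q S
    have key : (((q : ℤ) - 1) * ((A : ℤ) - (A' : ℤ)) : ℚ) =
        ((ε * (q : ℤ) ^ m * ((((q : ℤ) - 1) + ((q : ℤ) + 1) * ((q : ℤ) ^ n - 1)) - 2 * ((q : ℤ) ^ S - 1)) : ℤ) : ℚ) := by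
      push_cast
      linear_combination (ε * ((q : ℚ) - 1)) * hweld + (ε * (q : ℚ) ^ m * ((q : ℚ) + 1)) * h1 - (2 * ε * (q : ℚ) ^ m) * h2 -
        (((q : ℚ) - 1) * (((A : ℕ) : ℚ) - ((A' : ℕ) : ℚ))) * hε2
    exact_mod_cast key
  rw [hweldZ]
  linear_combination (-(ε * (q : ℤ) ^ m)) * hHZ

end Summit.HodgeConjecture.HodgeConjecture.Cruxes.H413.F0P3cDyRamCensusBottomArith
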